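import Summits.AtomisticToContinuum.FouriersLaw.Theses.BondHeatUncertainty
import Summits.AtomisticToContinuum.FouriersLaw.Theorems.BondHeatUncertaintySubdiffusiveBondHeatLocalEnergyMoment
import Summits.AtomisticToContinuum.FouriersLaw.Theorems.BondHeatUncertaintySubdiffusiveBondHeatBathBondReductionConditional
import Summits.AtomisticToContinuum.FouriersLaw.Theorems.BondHeatUncertaintySubdiffusiveBondHeatSiteEnergyDynkin
import Summits.AtomisticToContinuum.FouriersLaw.Theorems.BondHeatUncertaintySubdiffusiveBondHeatSiteEnergyCurrentCovariance
import Summits.AtomisticToContinuum.FouriersLaw.Theorems.BondHeatUncertaintySubdiffusiveBondHeatKernelDetailedBalance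
import Summits.AtomisticToContinuum.FouriersLaw.Theorems.BoundaryEscapeDeficitBoundaryKernelBasics

/-!
# `SubdiffusiveBondHeat` from the Edwards–Wilkinson law of the bath heat (line `bath-bond-deficit-integral`: the transfer)

Crux `stmt-AtomisticToContinuum-9120` (`BondHeatUncertainty.SubdiffusiveBondHeat`, (S)): for the pinned anharmonic chain
`pinnedChain ω₂ lam β γ` (all parameters `> 0`) with both Langevin baths at `T > 0`, an `N`-uniform bound
`V_N(b,t) ≤ A√t` on the equilibrium bond-heat variance of ONE bond for `1 ≤ t ≤ cN²`.

This file lands the whole PROVED content of the line `bath-bond-deficit-integral` (lead's skeleton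
`Cruxes/SubdiffusiveBondHeat/Lines/bath_bond_deficit_integral.lean`, generation-1 reshape) as kernel-checked transfer
theorems with the line's single open `N`-uniform statement as an explicit HYPOTHESIS (no new definition, no `sorry`):

* `subdiffusiveBondHeat_of_deficitCesaroEW` — (S) follows from the Cesàro Edwards–Wilkinson bound of the boundary
  escape-deficit curve, `∫₀ᵗ (1 − θ_N(s)) ds ≤ C √t` for `1 ≤ t ≤ cN²`, `N ≥ N₀`, where `θ_N(s) = (γ/T²)∫₀ˢ K_N`,
  `K_N(u) = ∫ (p₀² − T) · P_u(p₀² − T) dμ_T` are VERBATIM the `let θ`, `let K` of route `BoundaryEscapeDeficit`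
  (so an item stated in that vocabulary discharges the hypothesis by `exact`). By the landed bath-heat identity this
  hypothesis is the EW ¼-law `Var_eq(Q^L_t) ≤ 2γT²C√t` of the heat exchanged with one reservoir up to the Thouless time.
  Proof: witness bond `b = 0`; the landed bath-bond reduction `V_N(0,t) ≤ 4γT²∫₀ᵗ(1−θ_N) + 8E_{μ_T}[e₀²]`
  (`stub_bathBondReduction_of_kernelFacts` fed with the landed kernel detailed balance, Dynkin identity and static
  covariance bound) and the landed uniform statics `E_{μ_T}[e₀²] ≤ σ²` (`localEnergyMoment`).
* `subdiffusiveBondHeat_of_deficitUpperTail` — (S) from the POINTWISE tail `1 − θ_N(s) ≤ C/√s` on `[1, cN²]` (card A's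
  `C⁺`; the hinge `DeficitUpperTail` of line `contact-kolmogorov-triad`), through the bridge
  `pinnedChain_deficitIntegral_le_of_upperTail` (pointwise ⇒ Cesàro with `C ↦ 1 + 2γ + 2 max(C,0)`), which uses only the
  landed `BoundaryKernelBasics` (stmt-12239): `K_N` continuous (interval-integrability of the deficit curve) and
  `|K_N| ≤ 2T²` (the initial stretch `1 − θ_N(s) ≤ 1 + 2γs`), plus `∫₁ᵗ ds/√s = 2√t − 2`.

Nothing here closes the item: the hypotheses are the open, `N`-uniform content of (S) at the bath bond (open-problem
calibre, BLR2000 §6.3); the file is the glue `child → (S)` for a glued split of the crux.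
-/

noncomputable section

open MeasureTheory Set Filter Topology

namespace Summit.AtomisticToContinuum.FouriersLaw.Theorems.SubdiffusiveBondHeat

open Literature.MathematicalPhysics.KineticTheory.HeatConduction
open Summit.AtomisticToContinuum.FouriersLaw.Theses.BondHeatUncertainty (SubdiffusiveBondHeat)

/-! ### Fixed-`N` control of the deficit curve `1 − θ_N` (from the landed `BoundaryKernelBasics`) -/

section FixedN

variable {ω₂ lam β γ T : ℝ} (hω : 0 < ω₂) (hl : 0 < lam) (hβ : 0 < β) (hγ : 0 < γ) (hT : 0 < T) {N : ℕ}
  (hN : 0 < N)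
include hω hl hβ hγ hT hN

/-- `θ_N(s) = (γ/T²)∫₀ˢ K_N` is continuous in `s` (primitive of the continuous boundary kernel `K_N`,
`BoundaryKernelBasics` (b)). [folklore] -/
theorem pinnedChain_continuous_stepResponse :
    Continuous fun s : ℝ => γ / T ^ 2 * ∫ u in (0 : ℝ)..s,
      ∫ z, ((z.2 ⟨0, hN⟩) ^ 2 - T) *
          (∫ y, ((y.2 ⟨0, hN⟩) ^ 2 - T) ∂((pinnedChain ω₂ lam β γ).transitionKernel N T T u.toNNReal z))
        ∂((pinnedChain ω₂ lam β γ).gibbsMeasure N T) := by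
  obtain ⟨-, hKc, -, -, -⟩ := boundaryKernelBasics_proof ω₂ lam β γ hω hl hβ hγ T hT N hN
  simp only [dif_pos hN] at hKc
  exact continuous_const.mul (intervalIntegral.continuous_primitive (fun a b => hKc.intervalIntegrable a b) 0)

/-- The deficit curve is bounded on initial stretches: `1 − θ_N(s) ≤ 1 + 2γs` for `s ≥ 0`, from `|K_N| ≤ 2T²`
(`BoundaryKernelBasics` (c)). [folklore] -/
theorem pinnedChain_one_sub_stepResponse_le {s : ℝ} (hs : 0 ≤ s) :
    1 - γ / T ^ 2 * (∫ u in (0 : ℝ)..s,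
      ∫ z, ((z.2 ⟨0, hN⟩) ^ 2 - T) *
          (∫ y, ((y.2 ⟨0, hN⟩) ^ 2 - T) ∂((pinnedChain ω₂ lam β γ).transitionKernel N T T u.toNNReal z))
        ∂((pinnedChain ω₂ lam β γ).gibbsMeasure N T)) ≤ 1 + 2 * γ * s := by
  obtain ⟨-, -, hKb, -, -⟩ := boundaryKernelBasics_proof ω₂ lam β γ hω hl hβ hγ T hT N hN
  simp only [dif_pos hN] at hKb
  set K : ℝ → ℝ := fun u => ∫ z, ((z.2 ⟨0, hN⟩) ^ 2 - T) *
      (∫ y, ((y.2 ⟨0, hN⟩) ^ 2 - T) ∂((pinnedChain ω₂ lam β γ).transitionKernel N T T u.toNNReal z))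
    ∂((pinnedChain ω₂ lam β γ).gibbsMeasure N T) with hK
  have hb : ∀ x ∈ Set.uIoc (0 : ℝ) s, ‖K x‖ ≤ 2 * T ^ 2 := fun x _ => by
    rw [Real.norm_eq_abs]; exact hKb x
  have hI := intervalIntegral.norm_integral_le_of_norm_le_const hb
  rw [Real.norm_eq_abs, sub_zero, abs_of_nonneg hs] at hI
  have hT2 : 0 < T ^ 2 := by positivity
  have hγT : 0 ≤ γ / T ^ 2 := div_nonneg hγ.le hT2.le
  have h1 : |γ / T ^ 2 * ∫ u in (0 : ℝ)..s, K u| ≤ 2 * γ * s := by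
    rw [abs_mul, abs_of_nonneg hγT]
    calc γ / T ^ 2 * |∫ u in (0 : ℝ)..s, K u| ≤ γ / T ^ 2 * (2 * T ^ 2 * s) :=
          mul_le_mul_of_nonneg_left hI hγT
      _ = 2 * γ * s := by field_simp
  have h2 := neg_abs_le (γ / T ^ 2 * ∫ u in (0 : ℝ)..s, K u)
  linarith

/-- **Pointwise tail ⇒ Cesàro deficit bound** (the bridge for pointwise suppliers such as card A's `C⁺` / the triad's
`DeficitUpperTail`). For `N ≥ 1` and `1 ≤ t ≤ cN²`: if `1 − θ_N(s) ≤ C/√s` for all `s ∈ [1, cN²]` then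
`∫₀ᵗ (1 − θ_N(s)) ds ≤ (1 + 2γ + 2 max(C,0)) √t` (initial stretch `[0,1]` costs `≤ 1 + 2γ`; tail
`∫₁ᵗ max(C,0)/√s ds = 2 max(C,0)(√t − 1)`). [folklore] -/
theorem pinnedChain_deficitIntegral_le_of_upperTail {t C c : ℝ} (ht : 1 ≤ t) (htc : t ≤ c * (N : ℝ) ^ 2)
    (htail : ∀ s : ℝ, 1 ≤ s → s ≤ c * (N : ℝ) ^ 2 →
      1 - γ / T ^ 2 * (∫ u in (0 : ℝ)..s,
        ∫ z, ((z.2 ⟨0, hN⟩) ^ 2 - T) *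
            (∫ y, ((y.2 ⟨0, hN⟩) ^ 2 - T) ∂((pinnedChain ω₂ lam β γ).transitionKernel N T T u.toNNReal z))
          ∂((pinnedChain ω₂ lam β γ).gibbsMeasure N T)) ≤ C / Real.sqrt s) :
    (∫ s in (0 : ℝ)..t, (1 - γ / T ^ 2 * (∫ u in (0 : ℝ)..s,
        ∫ z, ((z.2 ⟨0, hN⟩) ^ 2 - T) *
            (∫ y, ((y.2 ⟨0, hN⟩) ^ 2 - T) ∂((pinnedChain ω₂ lam β γ).transitionKernel N T T u.toNNReal z))
          ∂((pinnedChain ω₂ lam β γ).gibbsMeasure N T)))) ≤ (1 + 2 * γ + 2 * max C 0) * Real.sqrt t := by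
  set f : ℝ → ℝ := fun s => 1 - γ / T ^ 2 * (∫ u in (0 : ℝ)..s,
      ∫ z, ((z.2 ⟨0, hN⟩) ^ 2 - T) *
          (∫ y, ((y.2 ⟨0, hN⟩) ^ 2 - T) ∂((pinnedChain ω₂ lam β γ).transitionKernel N T T u.toNNReal z))
        ∂((pinnedChain ω₂ lam β γ).gibbsMeasure N T)) with hf
  have hfc : Continuous f := continuous_const.sub (pinnedChain_continuous_stepResponse hω hl hβ hγ hT hN)
  have hfi : ∀ a b : ℝ, IntervalIntegrable f volume a b := fun a b => hfc.intervalIntegrable a b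
  have hsqrt0 : 0 ≤ Real.sqrt t := Real.sqrt_nonneg t
  have hsqrt1 : 1 ≤ Real.sqrt t := by rw [← Real.sqrt_one]; exact Real.sqrt_le_sqrt ht
  set C' : ℝ := max C 0 with hC'
  have hC'0 : 0 ≤ C' := le_max_right _ _
  -- split the Cesàro integral at `s = 1`
  have hsplit : (∫ s in (0 : ℝ)..t, f s) = (∫ s in (0 : ℝ)..1, f s) + ∫ s in (1 : ℝ)..t, f s :=
    (intervalIntegral.integral_add_adjacent_intervals (hfi 0 1) (hfi 1 t)).symm
  -- initial stretch
  have h01 : ∫ s in (0 : ℝ)..1, f s ≤ 1 + 2 * γ := by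
    have hmono : ∫ s in (0 : ℝ)..1, f s ≤ ∫ s in (0 : ℝ)..1, (1 + 2 * γ : ℝ) := by
      refine intervalIntegral.integral_mono_on zero_le_one (hfi 0 1) intervalIntegrable_const fun s hs => ?_
      have h1 := pinnedChain_one_sub_stepResponse_le hω hl hβ hγ hT hN hs.1
      have h2 : 2 * γ * s ≤ 2 * γ := by nlinarith [hs.2, hγ.le]
      simp only [hf]
      linarith
    rw [intervalIntegral.integral_const, sub_zero, smul_eq_mul, one_mul] at hmono
    exact hmono
  -- the tail
  have h1t : ∫ s in (1 : ℝ)..t, f s ≤ 2 * C' * Real.sqrt t := by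
    have hg : ∀ s ∈ Set.uIcc (1 : ℝ) t, HasDerivAt (fun x => 2 * C' * Real.sqrt x) (C' / Real.sqrt s) s := by
      intro s hs
      rw [Set.uIcc_of_le ht] at hs
      have hs0 : s ≠ 0 := by linarith [hs.1]
      have hd := (Real.hasDerivAt_sqrt hs0).const_mul (2 * C')
      have e : 2 * C' * (1 / (2 * Real.sqrt s)) = C' / Real.sqrt s := by
        have : Real.sqrt s ≠ 0 := Real.sqrt_ne_zero'.2 (by linarith [hs.1])
        field_simp
      rw [e] at hd
      exact hd
    have hgc : ContinuousOn (fun s => C' / Real.sqrt s) (Set.uIcc (1 : ℝ) t) := by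
      refine continuousOn_const.div Real.continuous_sqrt.continuousOn fun s hs => ?_
      rw [Set.uIcc_of_le ht] at hs
      exact Real.sqrt_ne_zero'.2 (by linarith [hs.1])
    have hgi : IntervalIntegrable (fun s => C' / Real.sqrt s) volume 1 t := hgc.intervalIntegrable
    have hFTC : ∫ s in (1 : ℝ)..t, C' / Real.sqrt s = 2 * C' * Real.sqrt t - 2 * C' * Real.sqrt 1 :=
      intervalIntegral.integral_eq_sub_of_hasDerivAt hg hgi
    have hmono : ∫ s in (1 : ℝ)..t, f s ≤ ∫ s in (1 : ℝ)..t, C' / Real.sqrt s := by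
      refine intervalIntegral.integral_mono_on ht (hfi 1 t) hgi fun s hs => ?_
      have hsc : s ≤ c * (N : ℝ) ^ 2 := hs.2.trans htc
      have h1 := htail s hs.1 hsc
      have hs0 : 0 < Real.sqrt s := Real.sqrt_pos.2 (by linarith [hs.1])
      have h2 : C / Real.sqrt s ≤ C' / Real.sqrt s := div_le_div_of_nonneg_right (le_max_left _ _) hs0.le
      simp only [hf]
      exact h1.trans h2
    rw [hFTC, Real.sqrt_one] at hmono
    have : 0 ≤ 2 * C' := by positivity
    linarith
  rw [hsplit]
  calc (∫ s in (0 : ℝ)..1, f s) + ∫ s in (1 : ℝ)..t, f s ≤ (1 + 2 * γ) + 2 * C' * Real.sqrt t := by linarith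
    _ ≤ (1 + 2 * γ) * Real.sqrt t + 2 * C' * Real.sqrt t := by
        have : 0 ≤ 1 + 2 * γ := by positivity
        nlinarith
    _ = (1 + 2 * γ + 2 * C') * Real.sqrt t := by ring

end FixedN

/-! ### The transfers -/

/-- **(S) from the Cesàro Edwards–Wilkinson bound of the boundary deficit curve** (= the EW ¼-law of the bath heat
`Var_eq(Q^L_t) = 2γT²∫₀ᵗ(1−θ_N) ≤ 2γT²C√t` up to the Thouless time), the single open stub `stub_deficitCesaroEW` of line
`bath-bond-deficit-integral` taken as a hypothesis, `θ_N`, `K_N` spelled VERBATIM as the `let θ`, `let K` of route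
`BoundaryEscapeDeficit`. Witness bond `b = 0`; constants `A = 4γT² max(C,0) + 8 max(σ²,0)`, same `c`,
`N₀ ↦ max(N₀, 2)`. [folklore] -/
theorem subdiffusiveBondHeat_of_deficitCesaroEW :
    (∀ ω₂ lam β γ : ℝ, 0 < ω₂ → 0 < lam → 0 < β → 0 < γ → ∀ T : ℝ, 0 < T → ∃ C c : ℝ, 0 < c ∧ ∃ N₀ : ℕ, ∀ N : ℕ, N₀ ≤ N → ∀ t : ℝ, 1 ≤ t → t ≤ c * (N : ℝ) ^ 2 → (∫ s in (0 : ℝ)..t, (1 - γ / T ^ 2 * (∫ u in (0 : ℝ)..s, if h : 0 < N then ∫ z, ((z.2 ⟨0, h⟩) ^ 2 - T) * (∫ y, ((y.2 ⟨0, h⟩) ^ 2 - T) ∂((Literature.MathematicalPhysics.KineticTheory.HeatConduction.pinnedChain ω₂ lam β γ).transitionKernel N T T u.toNNReal z)) ∂((Literature.MathematicalPhysics.KineticTheory.HeatConduction.pinnedChain ω₂ lam β γ).gibbsMeasure N T) else 0))) ≤ C * Real.sqrt t) → Summit.AtomisticToContinuum.FouriersLaw.Theses.BondHeatUncertainty.SubdiffusiveBondHeat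 := by
  intro h ω₂ lam β γ hω hl hβ hγ T hT
  obtain ⟨σ2, hσ⟩ := localEnergyMoment ω₂ lam β γ hω hl hβ hγ T hT
  obtain ⟨C, c, hc, N₀, hC⟩ := h ω₂ lam β γ hω hl hβ hγ T hT
  refine ⟨4 * γ * T ^ 2 * max C 0 + 8 * max σ2 0, c, hc, max N₀ 2, fun N hN => ⟨0, ?_, fun t ht htc => ?_⟩⟩
  · have h2 : 2 ≤ N := le_trans (le_max_right _ _) hN
    omega
  · have h2 : 1 < N := lt_of_lt_of_le (by norm_num) (le_trans (le_max_right _ _) hN)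
    have hN0 : 0 < N := Nat.zero_lt_of_lt h2
    have hN₀ : N₀ ≤ N := le_trans (le_max_left _ _) hN
    have ht0 : 0 ≤ t := le_trans zero_le_one ht
    have hsqrt0 : 0 ≤ Real.sqrt t := Real.sqrt_nonneg t
    have hsqrt1 : 1 ≤ Real.sqrt t := by rw [← Real.sqrt_one]; exact Real.sqrt_le_sqrt ht
    -- the Cesàro hypothesis at this `N`, `t`
    have hces := hC N hN₀ t ht htc
    simp only [dif_pos hN0] at hces
    -- the landed bath-bond reduction and statics
    have hred := stub_bathBondReduction_of_kernelFacts ω₂ lam β γ hω hl hβ hγ T hT N h2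
      (stub_kernelDetailedBalance ω₂ lam β γ hω hl hβ hγ T hT N h2)
      (stub_siteEnergyDynkin ω₂ lam β γ hω hl hβ hγ T hT N h2)
      (stub_siteEnergyCurrentCovariance ω₂ lam β γ hω hl hβ hγ T hT N h2) t ht0
    have hmom := hσ N h2
    simp only [dif_pos hN0]
    have hγT : 0 ≤ 4 * γ * T ^ 2 := by positivity
    have hces' := hces.trans (mul_le_mul_of_nonneg_right (le_max_left C 0) hsqrt0)
    have hmom' : ∫ z, ((z.2 ⟨0, Nat.zero_lt_of_lt h2⟩) ^ 2 / 2 +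
        (pinnedChain ω₂ lam β γ).U (z.1 ⟨0, Nat.zero_lt_of_lt h2⟩) +
        (pinnedChain ω₂ lam β γ).V (z.1 ⟨1, h2⟩ - z.1 ⟨0, Nat.zero_lt_of_lt h2⟩) / 2) ^ 2
          ∂((pinnedChain ω₂ lam β γ).gibbsMeasure N T) ≤ max σ2 0 * Real.sqrt t :=
      calc _ ≤ max σ2 0 := hmom.trans (le_max_left _ _)
        _ = max σ2 0 * 1 := (mul_one _).symm
        _ ≤ max σ2 0 * Real.sqrt t := mul_le_mul_of_nonneg_left hsqrt1 (le_max_right _ _)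
    have h1 := mul_le_mul_of_nonneg_left hces' hγT
    calc _ ≤ _ := hred
      _ ≤ 4 * γ * T ^ 2 * (max C 0 * Real.sqrt t) + 8 * (max σ2 0 * Real.sqrt t) := by linarith
      _ = (4 * γ * T ^ 2 * max C 0 + 8 * max σ2 0) * Real.sqrt t := by ring

/-- **(S) from the pointwise upper tail of the boundary deficit curve** `1 − θ_N(s) ≤ C/√s` on `[1, cN²]`, `N ≥ N₀`
(card A's `C⁺`; the hinge `DeficitUpperTail` of line `contact-kolmogorov-triad`; `θ_N`, `K_N` VERBATIM the `let`s of
route `BoundaryEscapeDeficit`), via the bridge `pinnedChain_deficitIntegral_le_of_upperTail` and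
`subdiffusiveBondHeat_of_deficitCesaroEW`. [folklore] -/
theorem subdiffusiveBondHeat_of_deficitUpperTail :
    (∀ ω₂ lam β γ : ℝ, 0 < ω₂ → 0 < lam → 0 < β → 0 < γ → ∀ T : ℝ, 0 < T → ∃ C c : ℝ, 0 < c ∧ ∃ N₀ : ℕ, ∀ N : ℕ, N₀ ≤ N → ∀ s : ℝ, 1 ≤ s → s ≤ c * (N : ℝ) ^ 2 → 1 - γ / T ^ 2 * (∫ u in (0 : ℝ)..s, if h : 0 < N then ∫ z, ((z.2 ⟨0, h⟩) ^ 2 - T) * (∫ y, ((y.2 ⟨0, h⟩) ^ 2 - T) ∂((Literature.MathematicalPhysics.KineticTheory.HeatConduction.pinnedChain ω₂ lam β γ).transitionKernel N T T u.toNNReal z)) ∂((Literature.MathematicalPhysics.KineticTheory.HeatConduction.pinnedChain ω₂ lam β γ).gibbsMeasure N T) else 0) ≤ C / Real.sqrt s) → Summit.AtomisticToContinuum.FouriersLaw.Theses.BondHeatUncertainty.SubdiffusiveBondHeat := by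
  intro h
  refine subdiffusiveBondHeat_of_deficitCesaroEW fun ω₂ lam β γ hω hl hβ hγ T hT => ?_
  obtain ⟨C, c, hc, N₀, hC⟩ := h ω₂ lam β γ hω hl hβ hγ T hT
  refine ⟨1 + 2 * γ + 2 * max C 0, c, hc, max N₀ 1, fun N hN t ht htc => ?_⟩
  have hN₀ : N₀ ≤ N := le_trans (le_max_left _ _) hN
  have hN1 : 0 < N := lt_of_lt_of_le Nat.one_pos (le_trans (le_max_right _ _) hN)
  have htail : ∀ s : ℝ, 1 ≤ s → s ≤ c * (N : ℝ) ^ 2 →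
      1 - γ / T ^ 2 * (∫ u in (0 : ℝ)..s,
        ∫ z, ((z.2 ⟨0, hN1⟩) ^ 2 - T) *
            (∫ y, ((y.2 ⟨0, hN1⟩) ^ 2 - T) ∂((pinnedChain ω₂ lam β γ).transitionKernel N T T u.toNNReal z))
          ∂((pinnedChain ω₂ lam β γ).gibbsMeasure N T)) ≤ C / Real.sqrt s := fun s hs hsc => by
    have h' := hC N hN₀ s hs hsc
    simp only [dif_pos hN1] at h'
    exact h'
  simp only [dif_pos hN1]
  exact pinnedChain_deficitIntegral_le_of_upperTail hω hl hβ hγ hT hN1 ht htc htail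

end Summit.AtomisticToContinuum.FouriersLaw.Theorems.SubdiffusiveBondHeat

end
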